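import Literature.AlgebraicGeometry.Motives.HodgeThetaAnnihilatorTimesRankOneTorus
import HarnessLib

/-!
# Rational tensors on `V₁ ⊕ V₂` killed by `Θ` are killed by `Θ₁ ⊕ 0` when `V₂` is the `H¹` of a CM elliptic curve `ℚ(φ₂)` and NO central skew Hodge endomorphism `b` of `V₁` has `Θ`-trace `tr(Θ₁ b) · tr(φ₂²) = tr(Θ₂ φ₂)` (Moonen–Zarhin 1999 Prop. (3.8): `Hg(X × E) = Hg(X) × Hg(E)` unless `End⁰(E) = k` embeds into the centre of `End⁰(X)` — the Lie step for a centre of ARBITRARY rank)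

Family `hodge`, layer `Literature/AlgebraicGeometry/Motives` (abstract polarizable `ℚ`-Hodge structures; no
geometry). Research context: cell `pub-hodge-ring2` (HONEST FRAMING: research route conditional on HC_CM; not a
corollary; Q11.4-sentence-2 already refuted in dim ≥ 3), Literature lane, programme R28 «row (5.11) of
Moonen–Zarhin's Thm. 0.2 (4): `E_k × E_{k'} × T`, `T` a simple abelian threefold of type IV(1,1) NOT of CM type,
`k, k' ≇ End⁰(T)`», abstract half. UNCONDITIONAL linear algebra / Hodge theory; theorems only (no definition, no
named fact, D-0026; nothing admitted); no step towards a summit statement. It is the sequel of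
`HodgeThetaAnnihilatorTimesRankOneTorus` (programme R24), which proves the same conclusion when EVERY `ψ₁`-skew
central Hodge endomorphism of `V₁` is a rational multiple of one `φ₁` (a centre of rank one: `X = T` simple of
type IV with imaginary quadratic centre); here the centre of `End_Hdg(V₁)` is ARBITRARY (e.g. `X = E_{k'} × T`,
centre `k' × k''` of rank two), which is what Prop. (3.8) allows.

PRINTED RESULTS, Lie-algebra form. B. Moonen, Yu. Zarhin, *Hodge classes on abelian varieties of low dimension*,
Math. Ann. 315 (1999) 711–733 [held: `paper:arxiv-math_9901113`], §3:
* (3.1) (p. 6): `hg(X₁ × X₂) ≅ 𝔤₁ ⊕ 𝔤₂ ⊕ Γ_φ ⊆ hg(X₁) ⊕ hg(X₂)`, «`𝔤₃ ≠ 0` … if and only if for some `m` and `n` the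
  Hodge ring `B(X₁^m × X₂^n)` is not generated by the elements coming from `B(X₁^m)` and `B(X₂^n)`»;
* Lemma (3.6) (p. 7): «Assume that the Hodge group `Hg(X₂)` is a `ℚ`-simple algebraic torus. … If
  `Hg(X) ≠ Hg(X₁) × Hg(X₂)` then the center of `Hg(X₁)` contains an algebraic torus which is `ℚ`-isogenous to
  `Hg(X₂)`»;
* Prop. (3.8) (p. 7): «Let `X` be an abelian variety and let `E` be an elliptic curve, both over `ℂ`. Suppose
  `Hom(E,X) = 0`. Then either `Hg(X × E) = Hg(X) × Hg(E)` or `End⁰(E) = k` is an imaginary quadratic field such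
  that there exists an embedding of `k` into the center of `End⁰(X)`», proof: «Write `C` for the center of
  `End⁰(X)` … `C = K_1 × ⋯ × K_m × F_1 × ⋯ × F_n` … The center `Z` of `Hg(X)` is contained in
  `U_{F_1} × ⋯ × U_{F_n}` … there is a homomorphism `U_k → U_{F_1} × ⋯ × U_{F_n}` with finite kernel»;
* §1 (p. 2): «the centre of `Hg(X)` is contained in … the centre `F` of `End⁰(X)`» with the Rosati involution
  acting by inversion (positivity: D. Mumford, *Abelian varieties*, §21).
P. Deligne, LNM 900 (1982), I Prop. 3.6 (`Hg` reductive) — the tree's `ThetaSubalgebra.center_sup_derived_eq` and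
`trace_mul_self_lt_zero_of_central` (the trace form of `V` is NEGATIVE DEFINITE on the centre of a rational
`𝔤 ⊆ 𝔰𝔭(V,ψ)` containing `Θ`).

THIS FILE. SETTING as in `HodgeThetaAnnihilatorTimesRankOneTorus`: a `ℚ`-space `U = ι₁V₁ ⊕ ι₂V₂`, effective
weight-one Hodge structures `H_U, H₁, H₂` (`ι_i` map pieces into pieces), polarizations `ψ₁, ψ₂`; on `V₂`,
`dim V₂ = 2` and a Hodge endomorphism `φ₂` with `φ₂² = -d₂ < 0` (the `H¹` of an elliptic curve with complex
multiplication by `k = ℚ(√-d₂)`). NO HYPOTHESIS on the centre of `End_Hdg(V₁)`. MAIN RESULT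
(`wordDerAt_incl_theta_proj_eq_zero_of_centre_times_cmCurve`, §1): if

  (NONRES) `tr(φ₂²) · tr(Θ₁ ∘ b_ℂ) ≠ tr(Θ₂ ∘ φ₂,ℂ)` for EVERY `ψ₁`-skew central Hodge endomorphism `b` of `V₁`
  (rational: `b ∈ End_Hdg(V₁)`, `b` commutes with `End_Hdg(V₁)`, `ψ₁(b·,·) + ψ₁(·,b·) = 0`),

then every rational coefficient tensor `q` on `U` killed slice by slice by the matrix of `Θ_U` is killed by the
matrix of the partial Hodge operator `ι₁ ∘ Θ₁ ∘ π₁` («`Θ_X ⊕ 0 ∈ Lie Hg(X × E)_ℂ`», i.e. `Hg(X × E) = Hg(X) × Hg(E)`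
read on tensor invariants) — the conclusion of the tree's rank-one theorem, so the typed-Künneth pipeline of
programmes R5/R24 applies verbatim to `X × E`. (NONRES) is the Lie shadow of «no embedding of `k` into the center
of `End⁰(X)`»: for `b` running through the `ψ₁`-skew part `⊕ 𝔲_{F_j}` of the centre, `tr(Θ₁ b)` is the
differential at `b` of the character through which the centre acts on `det H^{1,0}`, and `tr(Θ₂φ₂)/tr(φ₂²)` is the
slope of `Lie U_k`; for `V₁ = H¹(E_{k'} × T)` (`k' = ℚ(√-d')`, `End⁰(T) = ℚ(√-d'')` of multiplicities `(2,1)`)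
and `V₂ = H¹(E_k)` it reads `√d ∉ ℚ√d' + ℚ√d''`, i.e. `k ≇ k'` and `k ≇ k''` (geometric companion
`HodgeTheory/CentreTimesCMCurveInvariance`). The rank-one theorem of R24 is the case `b ∈ ℚφ₁`.

PROOF (R24 verbatim up to the reductive decomposition, then NEW). Let `𝔞 = annLie(q)` (killing `q`; commuting
with `ι₁aπ₁` (`a ∈ End_Hdg V₁`), `ι₂φ₂π₂` and the two projectors; skew for `ψ₁(π₁·,π₁·) + ψ₂(π₂·,π₂·)`), so
`Θ_U ∈ 𝔞_ℂ`. The `V₂`-corners of `𝔞` lie on the line `ℚφ₂` and commute, so (Goursat) `ι₁ 𝔡(𝔤)_ℂ π₁ ⊆ 𝔞_ℂ` for the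
corner algebra `𝔤 = c₁(𝔞) ∋_ℂ Θ₁`; `𝔤 = 𝔷(𝔤) ⊕ 𝔡(𝔤)` (Deligne), `Θ₁ = z + s`, `z ∈ 𝔷(𝔤)_ℂ`, `s ∈ 𝔡(𝔤)_ℂ`,
`Θ₂ = w₂φ₂,ℂ`. NEW: the trace form `tr(ZZ')` is negative definite on `𝔷(𝔤)` (`trace_mul_self_lt_zero_of_central`),
so a `ℚ`-basis `(Z_j)` of `𝔷(𝔤)` has a trace-dual basis `(Ž_j)` in `𝔷(𝔤)`; write `z = Σ_j w_j Z_j,ℂ` and pick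
`X_j ∈ 𝔞` with corners `(Z_j, c_jφ₂)`, `c_j ∈ ℚ`. Then `Θ_U - ι₁sπ₁ - Σ_j w_j X_j,ℂ = (w₂ - Σ_j w_jc_j)·ι₂φ₂,ℂπ₂ ∈ 𝔞_ℂ`.
If the coefficient is non-zero, `ι₂φ₂π₂ ∈ 𝔞_ℂ`, hence `ι₂Θ₂π₂ ∈ 𝔞_ℂ` and `ι₁Θ₁π₁ = Θ_U - ι₂Θ₂π₂ ∈ 𝔞_ℂ`. If it
vanishes, the RATIONAL element `b = Σ_j c_j Ž_j ∈ 𝔷(𝔤)` — a `ψ₁`-skew central Hodge endomorphism of `V₁` — has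
`tr(Θ₁ b) = tr(z b) = Σ_j w_j tr(Z_j b) = Σ_j w_j c_j = w₂ = tr(Θ₂φ₂)/tr(φ₂²)` (`tr(s b) = 0`), contradicting
(NONRES). (Moonen–Zarhin: a non-split `Hg(X × E)` maps `U_k` with finite kernel into the central torus
`Z ⊆ Π U_{F_j}` of `Hg(X)`; the rational vector `b` is the Lie shadow of that cocharacter, trace duality replacing
the semisimplicity of the isogeny category of `ℚ`-tori.)

§2 (`trace_theta_mul_baseChange_eq_add_of_central`): for a presentation `U = ι₁V₁ ⊕ ι₂V₂` by MORPHISMS of Hodge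
structures (the `H¹` of a product `A₁ × A₂`), a central Hodge endomorphism `b` of `U` has central Hodge corners
`π_i b ι_i` and `tr(Θ_U b) = tr(Θ₁ · π₁bι₁) + tr(Θ₂ · π₂bι₂)` — the bookkeeping that reduces (NONRES) for
`X = A₁ × A₂` to the two factors («`C = … × F_1 × ⋯ × F_n`»).

## References

* [MoonenZarhin1999LowDim] B. Moonen, Yu. Zarhin, Math. Ann. 315 (1999), §1, §3 (3.1), Lemma (3.6), Prop. (3.8)
  (held `paper:arxiv-math_9901113` pp. 2, 6–7). [cite: MoonenZarhin1999LowDim, §3 Prop. (3.8)]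
* [Deligne1982HodgeCycles] P. Deligne, LNM 900 (1982), I §3 Prop. 3.4, Prop. 3.6. [cite: Deligne1982HodgeCycles, I §3 Prop. 3.6]
* [Lombardo2016] D. Lombardo, Ann. Inst. Fourier 66 (2016), Lemma 3.4 (p. 1229) (the Goursat step). [cite: Lombardo2016, Lemma 3.4 (p. 1229)]
* [MumfordAV1970] D. Mumford, *Abelian Varieties*, §21 (Rosati positivity). [cite: MumfordAV1970, §21]
* [Humphreys1972] J. E. Humphreys, GTM 9, §5.1, §19.1. [cite: Humphreys1972, §5.1]
-/

noncomputable section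

open scoped TensorProduct
open CategoryTheory Module

namespace Literature.AlgebraicGeometry.Motives

namespace HodgeStructure

open Literature.RepresentationTheory.GeneralLinear

universe u

/-! ### §1 The product Lie step: an arbitrary centre times a CM elliptic curve -/

section Main

variable {U V₁ V₂ : Type u} [AddCommGroup U] [Module ℚ U] [AddCommGroup V₁] [Module ℚ V₁]
  [AddCommGroup V₂] [Module ℚ V₂] [Module.Finite ℚ U] [Module.Finite ℚ V₁] [Module.Finite ℚ V₂]
  [HodgeTensorFacts.{u, u}] {n : ℤ}
variable {M d m : ℕ}

omit [Module.Finite ℚ U] [Module.Finite ℚ V₁] [Module.Finite ℚ V₂] [HodgeTensorFacts.{u, u}] in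
/-- Complexification of a sum of bilinear forms, evaluated (a copy of the private lemma of
`HodgeThetaAnnihilatorTimesNonCMCurve`). [folklore] -/
private theorem baseChange_add_apply₃ (B B' : LinearMap.BilinForm ℚ U) (x y : ℂ ⊗[ℚ] U) :
    LinearMap.BilinForm.baseChange ℂ (B + B') x y =
      LinearMap.BilinForm.baseChange ℂ B x y + LinearMap.BilinForm.baseChange ℂ B' x y := by
  induction x using TensorProduct.induction_on with
  | zero => simp
  | tmul c v =>
    induction y using TensorProduct.induction_on with
    | zero => simp
    | tmul d w =>
      simp only [LinearMap.BilinForm.baseChange_tmul, LinearMap.add_apply, add_smul]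
    | add y y' hy hy' => rw [map_add, map_add, map_add, hy, hy']; abel
  | add x x' hx hx' =>
    rw [map_add, LinearMap.add_apply, map_add, map_add, LinearMap.add_apply, LinearMap.add_apply, hx, hx']
    abel

omit [Module.Finite ℚ V₂] [HodgeTensorFacts.{u, u}] in
/-- Base change of a rational multiple: `(c • T)_ℂ = c • T_ℂ` (a copy of the lemma of `HodgeLieWeightOneRankFourCube`).
[cite: Deligne1982HodgeCycles, I §3 (proof of Prop. 3.4)] -/
private theorem baseChange_ratCast_smul₃ (c : ℚ) (T : Module.End ℚ V₂) :
    (c • T).baseChange ℂ = (c : ℂ) • T.baseChange ℂ := by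
  refine TensorProduct.AlgebraTensorModule.ext fun z v => ?_
  rw [LinearMap.baseChange_tmul, LinearMap.smul_apply, LinearMap.smul_apply, LinearMap.baseChange_tmul,
    TensorProduct.smul_tmul', ← TensorProduct.smul_tmul, Rat.smul_def, smul_eq_mul]

omit [Module.Finite ℚ U] [Module.Finite ℚ V₁] [Module.Finite ℚ V₂] [HodgeTensorFacts.{u, u}] in
/-- Base change of a finite sum of rational operators. [folklore] -/
private theorem baseChange_finset_sum₃ {ι : Type*} (s : Finset ι) (T : ι → Module.End ℚ V₁) :
    (∑ j ∈ s, T j).baseChange ℂ = ∑ j ∈ s, (T j).baseChange ℂ := by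
  classical
  induction s using Finset.induction_on with
  | empty => rw [Finset.sum_empty, Finset.sum_empty, LinearMap.baseChange_zero]
  | insert a s ha ih => rw [Finset.sum_insert ha, Finset.sum_insert ha, LinearMap.baseChange_add, ih]

omit [Module.Finite ℚ U] [Module.Finite ℚ V₁] [Module.Finite ℚ V₂] [HodgeTensorFacts.{u, u}] in
/-- **An element of `𝔷_ℂ = spanC 𝔷` is a complex combination of the complexified vectors of a `ℚ`-basis of `𝔷`**
(`𝔷` a rational subspace of `End_ℚ(V₁)`; extension of scalars). [cite: Deligne1982HodgeCycles, I §3 (proof of Prop. 3.4)] -/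
theorem exists_eq_sum_smul_baseChange_of_mem_spanC {ι : Type*} [Fintype ι] (𝔷 : Submodule ℚ (Module.End ℚ V₁))
    (bZ : Module.Basis ι ℚ ↥𝔷) {z : Module.End ℂ (ℂ ⊗[ℚ] V₁)} (hz : z ∈ spanC 𝔷) :
    ∃ w : ι → ℂ, z = ∑ j, w j • ((bZ j : ↥𝔷) : Module.End ℚ V₁).baseChange ℂ := by
  classical
  have hle : spanC 𝔷 ≤ Submodule.span ℂ (Set.range fun j => ((bZ j : ↥𝔷) : Module.End ℚ V₁).baseChange ℂ) := by
    refine Submodule.span_le.2 ?_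
    rintro _ ⟨Z, hZ, rfl⟩
    dsimp only
    have hZsum : Z = ∑ j, (bZ.repr ⟨Z, hZ⟩ j) • ((bZ j : ↥𝔷) : Module.End ℚ V₁) := by
      have h := congrArg (Subtype.val : ↥𝔷 → Module.End ℚ V₁) (bZ.sum_repr ⟨Z, hZ⟩)
      rw [Submodule.coe_sum] at h
      simp only [Submodule.coe_smul] at h
      exact h.symm
    rw [hZsum, baseChange_finset_sum₃]
    refine Submodule.sum_mem _ fun j _ => ?_
    rw [LinearMap.baseChange_smul]
    exact Submodule.smul_of_tower_mem _ _ (Submodule.subset_span ⟨j, rfl⟩)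
  obtain ⟨w, hw⟩ := (Submodule.mem_span_range_iff_exists_fun ℂ).1 (hle hz)
  exact ⟨w, hw.symm⟩

/-- **Theorem (Moonen–Zarhin 1999 Prop. (3.8), Lie step, word model — arbitrary centre).** Let `U = ι₁V₁ ⊕ ι₂V₂`
be a presentation compatible with effective weight-one Hodge structures `H_U, H₁, H₂`, polarizations `ψ₁, ψ₂`;
`dim V₂ = 2` with `φ₂ ∈ End_Hdg(V₂)`, `φ₂² = -d₂ < 0` («`E` an elliptic curve with complex multiplication by
`k = ℚ(√-d₂)`»). Suppose (NONRES): `tr(φ₂²)·tr(Θ₁ ∘ b_ℂ) ≠ tr(Θ₂ ∘ φ₂,ℂ)` for every rational `b ∈ End_Hdg(V₁)`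
commuting with `End_Hdg(V₁)` and `ψ₁`-skew («no embedding of `k` into the center of `End⁰(X)`», read on the
centre of `Lie Hg(X) ⊆ ⊕ 𝔲_{F_j}`). Then every RATIONAL coefficient tensor `q` on `U` killed slice by slice by the
matrix of `Θ_U` is killed by the matrix of the partial Hodge operator `ι₁ ∘ Θ₁ ∘ π₁` — «`Hg(X × E) = Hg(X) × Hg(E)`»
read on tensor invariants; the conclusion of the tree's `wordDerAt_incl_theta_proj_eq_zero_of_rankOneCentre_times_cmCurve`
(the case of a centre of rank one), so the typed-Künneth pipeline applies verbatim. [cite: MoonenZarhin1999LowDim, §3 Prop. (3.8)]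
[cite: MoonenZarhin1999LowDim, §3 (3.1) and Lemma (3.6)] [cite: Deligne1982HodgeCycles, I §3 Prop. 3.4 and Prop. 3.6]
[cite: Lombardo2016, Lemma 3.4 (p. 1229)] [cite: MumfordAV1970, §21] -/
theorem wordDerAt_incl_theta_proj_eq_zero_of_centre_times_cmCurve (hn : n = 1) (HU : HodgeStructure U n)
    (H₁ : HodgeStructure V₁ n) (H₂ : HodgeStructure V₂ n) (heff₁ : H₁.IsEffective) (heff₂ : H₂.IsEffective)
    {ι₁ : V₁ →ₗ[ℚ] U} {π₁ : U →ₗ[ℚ] V₁} {ι₂ : V₂ →ₗ[ℚ] U} {π₂ : U →ₗ[ℚ] V₂}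
    (hπι₁ : π₁ ∘ₗ ι₁ = LinearMap.id) (hπι₂ : π₂ ∘ₗ ι₂ = LinearMap.id) (hπ₁ι₂ : π₁ ∘ₗ ι₂ = 0)
    (hπ₂ι₁ : π₂ ∘ₗ ι₁ = 0) (hsum : ι₁ ∘ₗ π₁ + ι₂ ∘ₗ π₂ = LinearMap.id)
    (hι₁F : ∀ p, ∀ x ∈ H₁.piece p (n - p), ι₁.baseChange ℂ x ∈ HU.piece p (n - p))
    (hι₂F : ∀ p, ∀ x ∈ H₂.piece p (n - p), ι₂.baseChange ℂ x ∈ HU.piece p (n - p))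
    (ψ₁ : H₁.Polarization) (ψ₂ : H₂.Polarization)
    {φ₂ : Module.End ℚ V₂} (hφ₂E : φ₂ ∈ H₂.endAlg) {d₂ : ℚ} (hd₂ : 0 < d₂) (hφ₂ : φ₂ * φ₂ = -(d₂ • 1))
    (hV₂ : Module.finrank ℚ V₂ = 2)
    (eQ : Module.Basis (Fin M) ℚ U) (q : (Fin d → Fin m × Fin M) → ℚ)
    {ΘU : Module.End ℂ (ℂ ⊗[ℚ] U)} (hΘU : ∀ p, ∀ x ∈ HU.piece p (n - p), ΘU x = ((2 * p - n : ℤ) : ℂ) • x)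
    {Θ₁ : Module.End ℂ (ℂ ⊗[ℚ] V₁)} (hΘ₁ : ∀ p, ∀ x ∈ H₁.piece p (n - p), Θ₁ x = ((2 * p - n : ℤ) : ℂ) • x)
    {Θ₂ : Module.End ℂ (ℂ ⊗[ℚ] V₂)} (hΘ₂ : ∀ p, ∀ x ∈ H₂.piece p (n - p), Θ₂ x = ((2 * p - n : ℤ) : ℂ) • x)
    (hres : ∀ b ∈ H₁.endAlg, (∀ a ∈ H₁.endAlg, b * a = a * b) →
      (∀ v w, ψ₁.form (b v) w + ψ₁.form v (b w) = 0) →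
      ((LinearMap.trace ℚ V₂ (φ₂ * φ₂) : ℚ) : ℂ) * LinearMap.trace ℂ _ (Θ₁ * b.baseChange ℂ) ≠
        LinearMap.trace ℂ _ (Θ₂ * φ₂.baseChange ℂ))
    (hΘq : ∀ u : Fin d → Fin m, wordDerAt ℂ (fun _ : Fin d =>
      LinearMap.toMatrix (Algebra.TensorProduct.basis ℂ eQ) (Algebra.TensorProduct.basis ℂ eQ) ΘU)
      (wordSlice (fun w => algebraMap ℚ ℂ (q w)) u) = 0)
    (u : Fin d → Fin m) :
    wordDerAt ℂ (fun _ : Fin d =>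
      LinearMap.toMatrix (Algebra.TensorProduct.basis ℂ eQ) (Algebra.TensorProduct.basis ℂ eQ)
        (ι₁.baseChange ℂ ∘ₗ Θ₁ ∘ₗ π₁.baseChange ℂ))
      (wordSlice (fun w => algebraMap ℚ ℂ (q w)) u) = 0 := by
  classical
  have hΘ₁C : Θ₁ ∈ H₁.hodgeLieC := H₁.mem_hodgeLieC_of_forall_piece hΘ₁
  have hΘ₂C : Θ₂ ∈ H₂.hodgeLieC := H₂.mem_hodgeLieC_of_forall_piece hΘ₂
  have hsum' : ι₂ ∘ₗ π₂ + ι₁ ∘ₗ π₁ = LinearMap.id := by rw [add_comm]; exact hsum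
  -- pointwise slot identities
  have e11 : ∀ v, π₁ (ι₁ v) = v := fun v => by
    rw [← LinearMap.comp_apply (f := π₁), hπι₁, LinearMap.id_apply]
  have e22 : ∀ w, π₂ (ι₂ w) = w := fun w => by
    rw [← LinearMap.comp_apply (f := π₂), hπι₂, LinearMap.id_apply]
  have e12 : ∀ w, π₁ (ι₂ w) = 0 := fun w => by
    rw [← LinearMap.comp_apply (f := π₁), hπ₁ι₂, LinearMap.zero_apply]
  have e21 : ∀ v, π₂ (ι₁ v) = 0 := fun v => by
    rw [← LinearMap.comp_apply (f := π₂), hπ₂ι₁, LinearMap.zero_apply]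
  -- `Θ` through the presentation
  have hΘι₁ := theta_incl_eq HU H₁ hι₁F hΘU hΘ₁
  have hΘι₂ := theta_incl_eq HU H₂ hι₂F hΘU hΘ₂
  have hΘπ₁ := proj_theta_eq HU H₁ H₂ hπι₁ hπ₁ι₂ hsum hι₁F hι₂F hΘU hΘ₁ hΘ₂
  have hΘπ₂ := proj_theta_eq HU H₂ H₁ hπι₂ hπ₂ι₁ hsum' hι₂F hι₁F hΘU hΘ₂ hΘ₁
  have hΘUdec : ΘU = ι₁.baseChange ℂ ∘ₗ Θ₁ ∘ₗ π₁.baseChange ℂ + ι₂.baseChange ℂ ∘ₗ Θ₂ ∘ₗ π₂.baseChange ℂ := by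
    apply LinearMap.ext
    intro y
    conv_lhs => rw [← incl_proj_add_baseChange hsum y]
    rw [map_add, hΘι₁, hΘι₂]
    rfl
  -- the commuting family: `ι₁ a π₁` (`a ∈ End_Hdg V₁`), `ι₂ φ₂ π₂`, the two projectors; the orthogonal-sum form
  set aF : (H₁.endAlg ⊕ Unit) ⊕ (Unit ⊕ Unit) → Module.End ℚ U :=
    Sum.elim (Sum.elim (fun a => ι₁ ∘ₗ (a : Module.End ℚ V₁) ∘ₗ π₁) (fun _ => ι₂ ∘ₗ φ₂ ∘ₗ π₂))
      (Sum.elim (fun _ => ι₁ ∘ₗ π₁) (fun _ => ι₂ ∘ₗ π₂)) with haF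
  set φ : LinearMap.BilinForm ℚ U := ψ₁.form.compl₁₂ π₁ π₁ + ψ₂.form.compl₁₂ π₂ π₂ with hφ
  have hφC : ∀ x y, φ.baseChange ℂ x y = ψ₁.form.baseChange ℂ (π₁.baseChange ℂ x) (π₁.baseChange ℂ y) +
      ψ₂.form.baseChange ℂ (π₂.baseChange ℂ x) (π₂.baseChange ℂ y) := fun x y => by
    rw [hφ, baseChange_add_apply₃, baseChange_compl₁₂_apply, baseChange_compl₁₂_apply]
  have hφapply : ∀ x y, φ x y = ψ₁.form (π₁ x) (π₁ y) + ψ₂.form (π₂ x) (π₂ y) := fun x y => by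
    rw [hφ, LinearMap.add_apply, LinearMap.add_apply, LinearMap.compl₁₂_apply, LinearMap.compl₁₂_apply]
  set 𝔞 : Submodule ℚ (Module.End ℚ U) := annLie φ eQ aF q with h𝔞
  -- `Θ_U ∈ 𝔞_ℂ`
  have hΘ𝔞 : ΘU ∈ spanC 𝔞 := by
    refine mem_spanC_annLie φ eQ aF q hΘq (fun i => ?_) (fun x y => ?_)
    · apply LinearMap.ext
      intro y
      rcases i with (a | _) | (_ | _)
      · change ΘU ((ι₁ ∘ₗ (a : Module.End ℚ V₁) ∘ₗ π₁).baseChange ℂ y) =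
          (ι₁ ∘ₗ (a : Module.End ℚ V₁) ∘ₗ π₁).baseChange ℂ (ΘU y)
        simp only [LinearMap.baseChange_comp, LinearMap.comp_apply]
        rw [hΘι₁, ← Module.End.mul_apply (f := Θ₁), commute_baseChange_of_mem_hodgeLieC H₁ hΘ₁C a,
          Module.End.mul_apply, hΘπ₁]
      · change ΘU ((ι₂ ∘ₗ φ₂ ∘ₗ π₂).baseChange ℂ y) = (ι₂ ∘ₗ φ₂ ∘ₗ π₂).baseChange ℂ (ΘU y)
        simp only [LinearMap.baseChange_comp, LinearMap.comp_apply]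
        rw [hΘι₂, ← Module.End.mul_apply (f := Θ₂), commute_baseChange_of_mem_hodgeLieC H₂ hΘ₂C ⟨φ₂, hφ₂E⟩,
          Module.End.mul_apply, hΘπ₂]
      · change ΘU ((ι₁ ∘ₗ π₁).baseChange ℂ y) = (ι₁ ∘ₗ π₁).baseChange ℂ (ΘU y)
        simp only [LinearMap.baseChange_comp, LinearMap.comp_apply]
        rw [hΘι₁, hΘπ₁]
      · change ΘU ((ι₂ ∘ₗ π₂).baseChange ℂ y) = (ι₂ ∘ₗ π₂).baseChange ℂ (ΘU y)
        simp only [LinearMap.baseChange_comp, LinearMap.comp_apply]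
        rw [hΘι₂, hΘπ₂]
    · rw [hφC, hφC, hΘπ₁, hΘπ₁, hΘπ₂, hΘπ₂, formBaseChange_skew_of_mem_hodgeLieC ψ₁ hΘ₁C,
        formBaseChange_skew_of_mem_hodgeLieC ψ₂ hΘ₂C]
      ring
  -- what membership in `𝔞` gives
  have hmem : ∀ X ∈ 𝔞, (∀ i, X * aF i = aF i * X) ∧ ∀ v w, φ (X v) w + φ v (X w) = 0 :=
    fun X hX => ((mem_annLie_iff φ eQ aF q X).1 hX).2
  have hP₁ : ∀ X ∈ 𝔞, X * (ι₁ ∘ₗ π₁) = (ι₁ ∘ₗ π₁) * X := fun X hX => (hmem X hX).1 (Sum.inr (Sum.inl ()))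
  have hP₂ : ∀ X ∈ 𝔞, X * (ι₂ ∘ₗ π₂) = (ι₂ ∘ₗ π₂) * X := fun X hX => (hmem X hX).1 (Sum.inr (Sum.inr ()))
  have hTa : ∀ X ∈ 𝔞, ∀ a : H₁.endAlg, X * (ι₁ ∘ₗ (a : Module.End ℚ V₁) ∘ₗ π₁) =
      (ι₁ ∘ₗ (a : Module.End ℚ V₁) ∘ₗ π₁) * X := fun X hX a => (hmem X hX).1 (Sum.inl (Sum.inl a))
  have hTφ₂ : ∀ X ∈ 𝔞, X * (ι₂ ∘ₗ φ₂ ∘ₗ π₂) = (ι₂ ∘ₗ φ₂ ∘ₗ π₂) * X :=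
    fun X hX => (hmem X hX).1 (Sum.inl (Sum.inr ()))
  -- the corners commute with `End_Hdg(V₁)` resp. `φ₂`, and are skew
  have hc₁comm : ∀ X ∈ 𝔞, ∀ a : H₁.endAlg, (π₁ ∘ₗ X ∘ₗ ι₁) * (a : Module.End ℚ V₁) =
      (a : Module.End ℚ V₁) * (π₁ ∘ₗ X ∘ₗ ι₁) := by
    intro X hX a
    apply LinearMap.ext
    intro v
    have h := congrArg (fun f : Module.End ℚ U => π₁ (f (ι₁ v))) (hTa X hX a)
    simp only [Module.End.mul_apply, LinearMap.comp_apply, e11] at h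
    simp only [Module.End.mul_apply, LinearMap.comp_apply]
    exact h
  have hc₂comm : ∀ X ∈ 𝔞, (π₂ ∘ₗ X ∘ₗ ι₂) * φ₂ = φ₂ * (π₂ ∘ₗ X ∘ₗ ι₂) := by
    intro X hX
    apply LinearMap.ext
    intro w
    have h := congrArg (fun g : Module.End ℚ U => π₂ (g (ι₂ w))) (hTφ₂ X hX)
    simp only [Module.End.mul_apply, LinearMap.comp_apply, e22] at h
    simp only [Module.End.mul_apply, LinearMap.comp_apply]
    exact h
  have hc₁skew : ∀ X ∈ 𝔞, ∀ v w, ψ₁.form ((π₁ ∘ₗ X ∘ₗ ι₁) v) w + ψ₁.form v ((π₁ ∘ₗ X ∘ₗ ι₁) w) = 0 := by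
    intro X hX v w
    have h := (hmem X hX).2 (ι₁ v) (ι₁ w)
    rw [apply_incl_eq_of_commute_projector hπι₁ (hP₁ X hX) v,
      apply_incl_eq_of_commute_projector hπι₁ (hP₁ X hX) w, hφapply, hφapply] at h
    simp only [e11, e21, map_zero, add_zero] at h
    simpa only [LinearMap.comp_apply] using h
  have hc₂skew : ∀ X ∈ 𝔞, ∀ v w, ψ₂.form ((π₂ ∘ₗ X ∘ₗ ι₂) v) w + ψ₂.form v ((π₂ ∘ₗ X ∘ₗ ι₂) w) = 0 := by
    intro X hX v w
    have h := (hmem X hX).2 (ι₂ v) (ι₂ w)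
    rw [apply_incl_eq_of_commute_projector hπι₂ (hP₂ X hX) v,
      apply_incl_eq_of_commute_projector hπι₂ (hP₂ X hX) w, hφapply, hφapply] at h
    simp only [e22, e12, map_zero, zero_add] at h
    simpa only [LinearMap.comp_apply] using h
  -- the `V₂`-corners lie on the line `ℚφ₂` (rank-one torus), hence commute
  have hc₂line : ∀ X ∈ 𝔞, ∃ c : ℚ, π₂ ∘ₗ X ∘ₗ ι₂ = c • φ₂ := fun X hX =>
    RankTwoCM.exists_eq_ratCast_smul_of_commute_of_skew H₂ hn heff₂ hV₂ ψ₂ hφ₂E hd₂ hφ₂ (hc₂comm X hX)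
      (hc₂skew X hX)
  have hc₂c : ∀ X ∈ 𝔞, ∀ X' ∈ 𝔞,
      (π₂ ∘ₗ X ∘ₗ ι₂) * (π₂ ∘ₗ X' ∘ₗ ι₂) = (π₂ ∘ₗ X' ∘ₗ ι₂) * (π₂ ∘ₗ X ∘ₗ ι₂) := by
    intro X hX X' hX'
    obtain ⟨c, hc⟩ := hc₂line X hX
    obtain ⟨c', hc'⟩ := hc₂line X' hX'
    rw [hc, hc', smul_mul_assoc, mul_smul_comm, smul_mul_assoc, mul_smul_comm, smul_comm]
  -- the Goursat step inside `𝔞`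
  have hbr𝔞 : ∀ X ∈ 𝔞, ∀ X' ∈ 𝔞,
      ι₁ ∘ₗ ((π₁ ∘ₗ X ∘ₗ ι₁) * (π₁ ∘ₗ X' ∘ₗ ι₁) - (π₁ ∘ₗ X' ∘ₗ ι₁) * (π₁ ∘ₗ X ∘ₗ ι₁)) ∘ₗ π₁ ∈ 𝔞 := by
    intro X hX X' hX'
    rw [← bracket_eq_incl_corner_bracket_proj hπι₁ hπι₂ hsum (hP₁ X hX) (hP₂ X hX) (hP₁ X' hX') (hP₂ X' hX')
      (hc₂c X hX X' hX')]
    exact commutator_mem_annLie φ eQ aF q hX hX'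
  -- the corner algebra `𝔤 = c₁(𝔞)`
  obtain ⟨cLin, hcLin⟩ : ∃ L : Module.End ℚ U →ₗ[ℚ] Module.End ℚ V₁, ∀ X, L X = π₁ ∘ₗ X ∘ₗ ι₁ :=
    ⟨{ toFun := fun X => π₁ ∘ₗ X ∘ₗ ι₁
       map_add' := fun X X' => by rw [LinearMap.add_comp, LinearMap.comp_add]
       map_smul' := fun c X => by rw [LinearMap.smul_comp, LinearMap.comp_smul, RingHom.id_apply] },
      fun X => rfl⟩
  set 𝔤 : Submodule ℚ (Module.End ℚ V₁) := 𝔞.map cLin with h𝔤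
  have h𝔤mem : ∀ {Y}, Y ∈ 𝔤 ↔ ∃ X ∈ 𝔞, π₁ ∘ₗ X ∘ₗ ι₁ = Y := by
    intro Y
    rw [h𝔤, Submodule.mem_map]
    simp only [hcLin]
  have hbr𝔤 : ∀ Y ∈ 𝔤, ∀ Y' ∈ 𝔤, Y * Y' - Y' * Y ∈ 𝔤 := by
    intro Y hY Y' hY'
    obtain ⟨X, hX, rfl⟩ := h𝔤mem.1 hY
    obtain ⟨X', hX', rfl⟩ := h𝔤mem.1 hY'
    refine h𝔤mem.2 ⟨_, hbr𝔞 X hX X' hX', ?_⟩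
    apply LinearMap.ext
    intro v
    simp only [LinearMap.comp_apply, LinearMap.sub_apply, Module.End.mul_apply, e11]
  have hcomm𝔤 : ∀ Y ∈ 𝔤, ∀ a : H₁.endAlg, Y * (a : Module.End ℚ V₁) = (a : Module.End ℚ V₁) * Y := by
    intro Y hY a
    obtain ⟨X, hX, rfl⟩ := h𝔤mem.1 hY
    exact hc₁comm X hX a
  have hskew𝔤 : ∀ Y ∈ 𝔤, ∀ v w, ψ₁.form (Y v) w + ψ₁.form v (Y w) = 0 := by
    intro Y hY v w
    obtain ⟨X, hX, rfl⟩ := h𝔤mem.1 hY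
    exact hc₁skew X hX v w
  have hspanC𝔤 : spanC 𝔤 = Submodule.span ℂ
      ((fun X : Module.End ℚ U => (π₁ ∘ₗ X ∘ₗ ι₁).baseChange ℂ) '' (𝔞 : Set _)) := by
    rw [spanC, h𝔤, Submodule.map_coe, Set.image_image]
    simp only [hcLin]
  -- `Θ₁ = c₁(Θ_U) ∈ 𝔤_ℂ`
  have hcorner : ∀ T ∈ spanC 𝔞, π₁.baseChange ℂ ∘ₗ T ∘ₗ ι₁.baseChange ℂ ∈ spanC 𝔤 := by
    intro T hT
    induction hT using Submodule.span_induction with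
    | mem Z hZ =>
      obtain ⟨X, hX, rfl⟩ := hZ
      rw [← LinearMap.baseChange_comp, ← LinearMap.baseChange_comp]
      exact baseChange_mem_spanC (h𝔤mem.2 ⟨X, hX, rfl⟩)
    | zero => rw [LinearMap.zero_comp, LinearMap.comp_zero]; exact Submodule.zero_mem _
    | add Z Z' _ _ hZ hZ' => rw [LinearMap.add_comp, LinearMap.comp_add]; exact Submodule.add_mem _ hZ hZ'
    | smul c Z _ hZ => rw [LinearMap.smul_comp, LinearMap.comp_smul]; exact Submodule.smul_mem _ c hZ
  have hΘ₁𝔤 : Θ₁ ∈ spanC 𝔤 := by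
    have h : Θ₁ = π₁.baseChange ℂ ∘ₗ ΘU ∘ₗ ι₁.baseChange ℂ := by
      apply LinearMap.ext
      intro x
      rw [LinearMap.comp_apply, LinearMap.comp_apply, hΘι₁, proj_incl_baseChange hπι₁]
    rw [h]
    exact hcorner ΘU hΘ𝔞
  -- brackets of elements of `𝔤_ℂ`, placed on `V₁`, lie in `𝔞_ℂ`
  have hD : ∀ Y ∈ spanC 𝔤, ∀ Y' ∈ spanC 𝔤,
      ι₁.baseChange ℂ ∘ₗ (Y * Y' - Y' * Y) ∘ₗ π₁.baseChange ℂ ∈ spanC 𝔞 := by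
    intro Y hY Y' hY'
    rw [hspanC𝔤] at hY hY'
    exact incl_bracket_proj_mem_spanC 𝔞 hbr𝔞 hY hY'

  -- Deligne reductivity `𝔤 = 𝔷(𝔤) ⊕ 𝔡(𝔤)`; `Θ₁ = z + s`
  set 𝔷 : Submodule ℚ (Module.End ℚ V₁) :=
    𝔤 ⊓ Subalgebra.toSubmodule (Subalgebra.centralizer ℚ (𝔤 : Set (Module.End ℚ V₁))) with h𝔷
  set 𝔡 : Submodule ℚ (Module.End ℚ V₁) := Submodule.span ℚ {B | ∃ X ∈ 𝔤, ∃ Y ∈ 𝔤, X * Y - Y * X = B} with h𝔡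
  have h𝔷mem : ∀ {Z}, Z ∈ 𝔷 ↔ Z ∈ 𝔤 ∧ ∀ Y ∈ 𝔤, Z * Y = Y * Z := fun {Z} =>
    Literature.Algebra.Lie.TraceSeparating.mem_center_iff 𝔤 Z
  have hdec : 𝔷 ⊔ 𝔡 = 𝔤 := ThetaSubalgebra.center_sup_derived_eq H₁ hn heff₁ ψ₁ 𝔤 hbr𝔤 hΘ₁ hΘ₁𝔤 hskew𝔤
  have hΘ' : Θ₁ ∈ spanC 𝔷 ⊔ spanC 𝔡 := by rw [← spanC_sup, hdec]; exact hΘ₁𝔤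
  obtain ⟨z, hz, s, hs, hzs⟩ := Submodule.mem_sup.1 hΘ'
  -- `ι₁ s π₁ ∈ 𝔞_ℂ` (Goursat)
  have hsmem : ι₁.baseChange ℂ ∘ₗ s ∘ₗ π₁.baseChange ℂ ∈ spanC 𝔞 :=
    incl_comp_proj_mem_spanC_of_mem_span_commutators 𝔞 hD (mem_span_commutators_baseChange_of_mem_spanC_derived hs)
  -- the elements of `𝔷(𝔤)` are `ψ₁`-skew central Hodge endomorphisms of `V₁`
  have h𝔷E : ∀ Z ∈ 𝔷, Z ∈ H₁.endAlg ∧ ∀ b ∈ H₁.endAlg, Z * b = b * Z := fun Z hZ =>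
    mem_endAlg_and_commute_of_mem_center H₁ 𝔤 hΘ₁ hΘ₁𝔤 hcomm𝔤 (h𝔷mem.1 hZ).1 (h𝔷mem.1 hZ).2
  -- `Θ₂ = w₂ φ₂,ℂ`, `tr(Θ₂φ₂) = w₂·tr(φ₂²)`
  obtain ⟨w₂, hw₂⟩ := RankTwoCM.exists_eq_smul_of_commute_of_skew H₂ hn heff₂ hV₂ ψ₂ hφ₂E hd₂ hφ₂ (Y := Θ₂)
    (commute_baseChange_of_mem_hodgeLieC H₂ hΘ₂C ⟨φ₂, hφ₂E⟩)
    (fun x y => by rw [formBaseChange_skew_of_mem_hodgeLieC ψ₂ hΘ₂C, neg_add_cancel])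
  have htr₂ : LinearMap.trace ℂ _ (Θ₂ * φ₂.baseChange ℂ) = w₂ * ((LinearMap.trace ℚ V₂ (φ₂ * φ₂) : ℚ) : ℂ) := by
    rw [hw₂, smul_mul_assoc, map_smul, ← LinearMap.baseChange_mul, LinearMap.trace_baseChange, smul_eq_mul]
    rfl
  -- NEW: the trace form is non-degenerate on `𝔷(𝔤)`; a basis and its trace-dual basis
  set B : LinearMap.BilinForm ℚ ↥𝔷 :=
    ((LinearMap.mul ℚ (Module.End ℚ V₁)).compr₂ (LinearMap.trace ℚ V₁)).compl₁₂ 𝔷.subtype 𝔷.subtype with hBdef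
  have hB : ∀ x y : ↥𝔷, B x y = LinearMap.trace ℚ V₁ ((x : Module.End ℚ V₁) * (y : Module.End ℚ V₁)) :=
    fun x y => rfl
  have hdef : ∀ x : ↥𝔷, B x x = 0 → x = 0 := fun x hx => by
    obtain ⟨hx𝔤, hxc⟩ := h𝔷mem.1 x.2
    exact Subtype.ext (eq_zero_of_central_of_trace_mul_self_eq_zero H₁ ψ₁ 𝔤 hΘ₁ hΘ₁𝔤 hskew𝔤 hx𝔤 hxc
      (by rw [← hB]; exact hx))
  have hBnd : B.Nondegenerate := ⟨fun x hx => hdef x (hx x), fun y hy => hdef y (hy y)⟩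
  set bZ := Module.finBasis ℚ ↥𝔷 with hbZ
  set dZ := B.dualBasis hBnd bZ with hdZ
  have hdual : ∀ i j, LinearMap.trace ℚ V₁ (((dZ i : ↥𝔷) : Module.End ℚ V₁) * ((bZ j : ↥𝔷) : Module.End ℚ V₁)) =
      if j = i then 1 else 0 := fun i j => by
    rw [← hB]; exact B.apply_dualBasis_left hBnd bZ i j
  -- `z = Σ_j w_j Z_j,ℂ`
  obtain ⟨w, hw⟩ := exists_eq_sum_smul_baseChange_of_mem_spanC 𝔷 bZ hz
  -- `X_j ∈ 𝔞` with corners `(Z_j, c_j φ₂)`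
  have hXj : ∀ j, ∃ X ∈ 𝔞, π₁ ∘ₗ X ∘ₗ ι₁ = ((bZ j : ↥𝔷) : Module.End ℚ V₁) := fun j =>
    h𝔤mem.1 (h𝔷mem.1 (bZ j).2).1
  choose X hX𝔞 hXc using hXj
  have hcj : ∀ j, ∃ c : ℚ, π₂ ∘ₗ X j ∘ₗ ι₂ = c • φ₂ := fun j => hc₂line (X j) (hX𝔞 j)
  choose c hc using hcj
  -- the placing map `Y ↦ ι₁,ℂ Y π₁,ℂ` and the line `Φ₂ = ι₂,ℂ φ₂,ℂ π₂,ℂ`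
  obtain ⟨incl, hincl⟩ : ∃ L : Module.End ℂ (ℂ ⊗[ℚ] V₁) →ₗ[ℂ] Module.End ℂ (ℂ ⊗[ℚ] U),
      ∀ Y, L Y = ι₁.baseChange ℂ ∘ₗ Y ∘ₗ π₁.baseChange ℂ :=
    ⟨{ toFun := fun Y => ι₁.baseChange ℂ ∘ₗ Y ∘ₗ π₁.baseChange ℂ
       map_add' := fun Y Y' => by rw [LinearMap.add_comp, LinearMap.comp_add]
       map_smul' := fun a Y => by rw [LinearMap.smul_comp, LinearMap.comp_smul, RingHom.id_apply] },
      fun Y => rfl⟩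
  set Φ₂ : Module.End ℂ (ℂ ⊗[ℚ] U) := ι₂.baseChange ℂ ∘ₗ φ₂.baseChange ℂ ∘ₗ π₂.baseChange ℂ with hΦ₂
  have hΘ₂eq : ι₂.baseChange ℂ ∘ₗ Θ₂ ∘ₗ π₂.baseChange ℂ = w₂ • Φ₂ := by
    rw [hw₂, LinearMap.smul_comp, LinearMap.comp_smul]
  have hΘUdec' : ΘU = incl z + incl s + w₂ • Φ₂ := by
    rw [hΘUdec, hΘ₂eq, ← hzs, hincl, hincl, LinearMap.add_comp, LinearMap.comp_add]
  have hXC : ∀ j, (X j).baseChange ℂ = incl (((bZ j : ↥𝔷) : Module.End ℚ V₁).baseChange ℂ) + (c j : ℂ) • Φ₂ :=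
    fun j => by
    rw [baseChange_eq_incl_corner_add hπι₁ hπι₂ hsum (hP₁ _ (hX𝔞 j)) (hP₂ _ (hX𝔞 j)), hXc, hc, baseChange_ratCast_smul₃,
      LinearMap.smul_comp, LinearMap.comp_smul, hincl]
  have hsumX : ∑ j, w j • (X j).baseChange ℂ = incl z + (∑ j, w j * (c j : ℂ)) • Φ₂ := by
    simp only [hXC, smul_add, smul_smul, Finset.sum_add_distrib, Finset.sum_smul]
    rw [hw, map_sum]
    simp only [map_smul]
  -- `Θ_U - ι₁ s π₁ - Σ_j w_j X_j,ℂ = (w₂ - Σ_j w_j c_j) Φ₂ ∈ 𝔞_ℂ`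
  have hT : ΘU - incl s - ∑ j, w j • (X j).baseChange ℂ = (w₂ - ∑ j, w j * (c j : ℂ)) • Φ₂ := by
    rw [hsumX, hΘUdec']
    module
  have hTmem : (w₂ - ∑ j, w j * (c j : ℂ)) • Φ₂ ∈ spanC 𝔞 := by
    rw [← hT, hincl]
    exact Submodule.sub_mem _ (Submodule.sub_mem _ hΘ𝔞 hsmem)
      (Submodule.sum_mem _ fun j _ => Submodule.smul_mem _ _ (baseChange_mem_spanC (hX𝔞 j)))
  -- goal: `ι₁ Θ₁ π₁ ∈ 𝔞_ℂ`
  suffices hgoal : ι₁.baseChange ℂ ∘ₗ Θ₁ ∘ₗ π₁.baseChange ℂ ∈ spanC 𝔞 from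
    wordDerAt_eq_zero_of_mem_spanC_annLie φ eQ aF q hgoal u
  by_cases hκ : w₂ - ∑ j, w j * (c j : ℂ) = 0
  · -- resonance: the rational vector `b = Σ_j c_j Ž_j ∈ 𝔷(𝔤)` violates (NONRES)
    exfalso
    set b : Module.End ℚ V₁ := ∑ i, c i • ((dZ i : ↥𝔷) : Module.End ℚ V₁) with hbdef
    have hb𝔷 : b ∈ 𝔷 := Submodule.sum_mem _ fun i _ => Submodule.smul_mem _ _ (dZ i).2
    obtain ⟨hbE, hbc⟩ := h𝔷E b hb𝔷
    have hbskew : ∀ v w, ψ₁.form (b v) w + ψ₁.form v (b w) = 0 := hskew𝔤 b (h𝔷mem.1 hb𝔷).1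
    have hbcomm : ∀ Y ∈ 𝔤, b * Y = Y * b := (h𝔷mem.1 hb𝔷).2
    -- `tr(Z_j b) = c_j`
    have htrZb : ∀ j, LinearMap.trace ℚ V₁ (((bZ j : ↥𝔷) : Module.End ℚ V₁) * b) = c j := fun j => by
      have h1 : ∀ i, LinearMap.trace ℚ V₁ (((bZ j : ↥𝔷) : Module.End ℚ V₁) *
          (c i • ((dZ i : ↥𝔷) : Module.End ℚ V₁))) = if j = i then c i else 0 := fun i => by
        rw [mul_smul_comm, map_smul, LinearMap.trace_mul_comm, hdual, smul_eq_mul, mul_ite, mul_one, mul_zero]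
      rw [hbdef, Finset.mul_sum, map_sum]
      simp only [h1, Finset.sum_ite_eq, Finset.mem_univ, if_true]
    -- `tr(Θ₁ b_ℂ) = Σ_j w_j c_j = w₂`
    have htrb : LinearMap.trace ℂ _ (Θ₁ * b.baseChange ℂ) = w₂ := by
      have h1 : ∀ j, LinearMap.trace ℂ _ ((w j • ((bZ j : ↥𝔷) : Module.End ℚ V₁).baseChange ℂ) * b.baseChange ℂ) =
          w j * (c j : ℂ) := fun j => by
        rw [smul_mul_assoc, map_smul, ← LinearMap.baseChange_mul, LinearMap.trace_baseChange, htrZb, smul_eq_mul]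
        rfl
      rw [← hzs, add_mul, map_add, trace_spanC_derived_mul_baseChange_eq_zero 𝔤 hbcomm hs, add_zero, hw,
        Finset.sum_mul, map_sum]
      simp only [h1]
      exact (sub_eq_zero.1 hκ).symm
    exact hres b hbE hbc hbskew (by rw [htrb, htr₂, mul_comm])
  · -- non-resonance: `Φ₂ ∈ 𝔞_ℂ`, hence `ι₂Θ₂π₂ ∈ 𝔞_ℂ` and `ι₁Θ₁π₁ = Θ_U - ι₂Θ₂π₂ ∈ 𝔞_ℂ`
    have hφ₂mem : Φ₂ ∈ spanC 𝔞 := by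
      have h := Submodule.smul_mem _ (w₂ - ∑ j, w j * (c j : ℂ))⁻¹ hTmem
      rwa [smul_smul, inv_mul_cancel₀ hκ, one_smul] at h
    have hΘ₂mem : ι₂.baseChange ℂ ∘ₗ Θ₂ ∘ₗ π₂.baseChange ℂ ∈ spanC 𝔞 := by
      rw [hΘ₂eq]
      exact Submodule.smul_mem _ _ hφ₂mem
    have hΘ₁eq : ι₁.baseChange ℂ ∘ₗ Θ₁ ∘ₗ π₁.baseChange ℂ = ΘU - ι₂.baseChange ℂ ∘ₗ Θ₂ ∘ₗ π₂.baseChange ℂ := by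
      rw [hΘUdec, add_sub_cancel_right]
    rw [hΘ₁eq]
    exact Submodule.sub_mem _ hΘ𝔞 hΘ₂mem

end Main

/-! ### §2 Central Hodge endomorphisms of a sum presentation: central corners, additive `Θ`-trace -/

section Presentation

variable {U V₁ V₂ : Type u} [AddCommGroup U] [Module ℚ U] [AddCommGroup V₁] [Module ℚ V₁]
  [AddCommGroup V₂] [Module ℚ V₂] [Module.Finite ℚ U] [Module.Finite ℚ V₁] [Module.Finite ℚ V₂] {n : ℤ}

/-- **The corners of a central Hodge endomorphism of `U = ι₁V₁ ⊕ ι₂V₂` are central Hodge endomorphisms, and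
`tr(Θ_U ∘ b_ℂ) = tr(Θ₁ ∘ (π₁bι₁)_ℂ) + tr(Θ₂ ∘ (π₂bι₂)_ℂ)`** — for a presentation by MORPHISMS of Hodge structures
(`ι_i : H_i → H_U`, `π_i : H_U → H_i` with `π_iι_i = 1`, `π_iι_j = 0`, `ι₁π₁ + ι₂π₂ = 1`; the `H¹` of `A₁ × A₂`):
`b` commutes with the projectors `ι_iπ_i ∈ End_Hdg(U)`, so `b = ι₁(π₁bι₁)π₁ + ι₂(π₂bι₂)π₂`; `π_ibι_i` commutes with
`a ∈ End_Hdg(V_i)` because `b` commutes with `ι_iaπ_i ∈ End_Hdg(U)`; and `Θ_U = ι₁Θ₁π₁ + ι₂Θ₂π₂`. («Write `C` for the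
center of `End⁰(X)`. Then `C = K_1 × ⋯ × F_n`»: the centre of `End⁰(A₁ × A₂)` projects into the centres of the
factors, and the character `tr(Θ ·)` is additive.) [cite: MoonenZarhin1999LowDim, §3 Prop. (3.8) (proof)]
[cite: Deligne1982HodgeCycles, I §3 Prop. 3.4] -/
theorem trace_theta_mul_baseChange_eq_add_of_central (HU : HodgeStructure U n) (H₁ : HodgeStructure V₁ n)
    (H₂ : HodgeStructure V₂ n) (ι₁ : Hom H₁ HU) (π₁ : Hom HU H₁) (ι₂ : Hom H₂ HU) (π₂ : Hom HU H₂)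
    (hπι₁ : π₁.toLinearMap ∘ₗ ι₁.toLinearMap = LinearMap.id) (hπι₂ : π₂.toLinearMap ∘ₗ ι₂.toLinearMap = LinearMap.id)
    (hπ₁ι₂ : π₁.toLinearMap ∘ₗ ι₂.toLinearMap = 0) (hπ₂ι₁ : π₂.toLinearMap ∘ₗ ι₁.toLinearMap = 0)
    (hsum : ι₁.toLinearMap ∘ₗ π₁.toLinearMap + ι₂.toLinearMap ∘ₗ π₂.toLinearMap = LinearMap.id)
    {ΘU : Module.End ℂ (ℂ ⊗[ℚ] U)} (hΘU : ∀ p, ∀ x ∈ HU.piece p (n - p), ΘU x = ((2 * p - n : ℤ) : ℂ) • x)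
    {Θ₁ : Module.End ℂ (ℂ ⊗[ℚ] V₁)} (hΘ₁ : ∀ p, ∀ x ∈ H₁.piece p (n - p), Θ₁ x = ((2 * p - n : ℤ) : ℂ) • x)
    {Θ₂ : Module.End ℂ (ℂ ⊗[ℚ] V₂)} (hΘ₂ : ∀ p, ∀ x ∈ H₂.piece p (n - p), Θ₂ x = ((2 * p - n : ℤ) : ℂ) • x)
    {b : Module.End ℚ U} (hbE : b ∈ HU.endAlg) (hbc : ∀ a ∈ HU.endAlg, b * a = a * b) :
    (π₁.toLinearMap ∘ₗ b ∘ₗ ι₁.toLinearMap ∈ H₁.endAlg ∧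
        ∀ a ∈ H₁.endAlg, (π₁.toLinearMap ∘ₗ b ∘ₗ ι₁.toLinearMap) * a = a * (π₁.toLinearMap ∘ₗ b ∘ₗ ι₁.toLinearMap)) ∧
      (π₂.toLinearMap ∘ₗ b ∘ₗ ι₂.toLinearMap ∈ H₂.endAlg ∧
        ∀ a ∈ H₂.endAlg, (π₂.toLinearMap ∘ₗ b ∘ₗ ι₂.toLinearMap) * a = a * (π₂.toLinearMap ∘ₗ b ∘ₗ ι₂.toLinearMap)) ∧
      LinearMap.trace ℂ _ (ΘU * b.baseChange ℂ) =
        LinearMap.trace ℂ _ (Θ₁ * (π₁.toLinearMap ∘ₗ b ∘ₗ ι₁.toLinearMap).baseChange ℂ) +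
          LinearMap.trace ℂ _ (Θ₂ * (π₂.toLinearMap ∘ₗ b ∘ₗ ι₂.toLinearMap).baseChange ℂ) := by
  -- piece compatibility of the inclusions
  have hι₁F : ∀ p, ∀ x ∈ H₁.piece p (n - p), ι₁.toLinearMap.baseChange ℂ x ∈ HU.piece p (n - p) :=
    fun p x hx => ι₁.map_piece_le p _ ⟨x, hx, rfl⟩
  have hι₂F : ∀ p, ∀ x ∈ H₂.piece p (n - p), ι₂.toLinearMap.baseChange ℂ x ∈ HU.piece p (n - p) :=
    fun p x hx => ι₂.map_piece_le p _ ⟨x, hx, rfl⟩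
  have hsum' : ι₂.toLinearMap ∘ₗ π₂.toLinearMap + ι₁.toLinearMap ∘ₗ π₁.toLinearMap = LinearMap.id := by
    rw [add_comm]; exact hsum
  -- the projectors are Hodge endomorphisms, so `b` commutes with them
  have hP₁E : ι₁.toLinearMap ∘ₗ π₁.toLinearMap ∈ HU.endAlg := (ι₁.comp π₁).toLinearMap_mem_endAlg
  have hP₂E : ι₂.toLinearMap ∘ₗ π₂.toLinearMap ∈ HU.endAlg := (ι₂.comp π₂).toLinearMap_mem_endAlg
  have hbP₁ : b * (ι₁.toLinearMap ∘ₗ π₁.toLinearMap) = (ι₁.toLinearMap ∘ₗ π₁.toLinearMap) * b := hbc _ hP₁E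
  have hbP₂ : b * (ι₂.toLinearMap ∘ₗ π₂.toLinearMap) = (ι₂.toLinearMap ∘ₗ π₂.toLinearMap) * b := hbc _ hP₂E
  -- pointwise slot identities
  have e11 : ∀ v, π₁.toLinearMap (ι₁.toLinearMap v) = v := fun v => by
    rw [← LinearMap.comp_apply (f := π₁.toLinearMap), hπι₁, LinearMap.id_apply]
  have e22 : ∀ v, π₂.toLinearMap (ι₂.toLinearMap v) = v := fun v => by
    rw [← LinearMap.comp_apply (f := π₂.toLinearMap), hπι₂, LinearMap.id_apply]
  -- central corners
  have hcorner : ∀ {W : Type u} [AddCommGroup W] [Module ℚ W] (HW : HodgeStructure W n) (ι : Hom HW HU)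
      (π : Hom HU HW), (∀ v, π.toLinearMap (ι.toLinearMap v) = v) →
      b * (ι.toLinearMap ∘ₗ π.toLinearMap) = (ι.toLinearMap ∘ₗ π.toLinearMap) * b →
      π.toLinearMap ∘ₗ b ∘ₗ ι.toLinearMap ∈ HW.endAlg ∧
        ∀ a ∈ HW.endAlg, (π.toLinearMap ∘ₗ b ∘ₗ ι.toLinearMap) * a = a * (π.toLinearMap ∘ₗ b ∘ₗ ι.toLinearMap) := by
    intro W _ _ HW ι π e hbP
    refine ⟨((π.comp (endAlg.toHom ⟨b, hbE⟩)).comp ι).toLinearMap_mem_endAlg, fun a ha => ?_⟩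
    have haU : ι.toLinearMap ∘ₗ a ∘ₗ π.toLinearMap ∈ HU.endAlg :=
      ((ι.comp (endAlg.toHom ⟨a, ha⟩)).comp π).toLinearMap_mem_endAlg
    have h := hbc _ haU
    apply LinearMap.ext
    intro v
    have hv := congrArg (fun f : Module.End ℚ U => π.toLinearMap (f (ι.toLinearMap v))) h
    -- `π b ι a v = π b (ι a π) ι v = π (ι a π) b ι v = a π b ι v`
    simp only [Module.End.mul_apply, LinearMap.comp_apply, e] at hv
    simp only [Module.End.mul_apply, LinearMap.comp_apply]
    exact hv
  refine ⟨hcorner H₁ ι₁ π₁ e11 hbP₁, hcorner H₂ ι₂ π₂ e22 hbP₂, ?_⟩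
  -- the trace: `Θ_U = ι₁Θ₁π₁ + ι₂Θ₂π₂`, `b = ι₁b₁π₁ + ι₂b₂π₂`
  have hΘι₁ := theta_incl_eq HU H₁ hι₁F hΘU hΘ₁
  have hΘι₂ := theta_incl_eq HU H₂ hι₂F hΘU hΘ₂
  have hΘUdec : ΘU = ι₁.toLinearMap.baseChange ℂ ∘ₗ Θ₁ ∘ₗ π₁.toLinearMap.baseChange ℂ +
      ι₂.toLinearMap.baseChange ℂ ∘ₗ Θ₂ ∘ₗ π₂.toLinearMap.baseChange ℂ := by
    apply LinearMap.ext
    intro y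
    conv_lhs => rw [← incl_proj_add_baseChange hsum y]
    rw [map_add, hΘι₁, hΘι₂]
    rfl
  have hbdec := baseChange_eq_incl_corner_add hπι₁ hπι₂ hsum hbP₁ hbP₂
  set b₁ := π₁.toLinearMap ∘ₗ b ∘ₗ ι₁.toLinearMap with hb₁
  set b₂ := π₂.toLinearMap ∘ₗ b ∘ₗ ι₂.toLinearMap with hb₂
  have hπι₁C : π₁.toLinearMap.baseChange ℂ ∘ₗ ι₁.toLinearMap.baseChange ℂ = LinearMap.id := by
    rw [← LinearMap.baseChange_comp, hπι₁, LinearMap.baseChange_id]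
  have hπι₂C : π₂.toLinearMap.baseChange ℂ ∘ₗ ι₂.toLinearMap.baseChange ℂ = LinearMap.id := by
    rw [← LinearMap.baseChange_comp, hπι₂, LinearMap.baseChange_id]
  have hπ₁ι₂C : π₁.toLinearMap.baseChange ℂ ∘ₗ ι₂.toLinearMap.baseChange ℂ = 0 := by
    rw [← LinearMap.baseChange_comp, hπ₁ι₂, LinearMap.baseChange_zero]
  have hπ₂ι₁C : π₂.toLinearMap.baseChange ℂ ∘ₗ ι₁.toLinearMap.baseChange ℂ = 0 := by
    rw [← LinearMap.baseChange_comp, hπ₂ι₁, LinearMap.baseChange_zero]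
  -- the product, block by block
  have hprod : ΘU * b.baseChange ℂ =
      ι₁.toLinearMap.baseChange ℂ ∘ₗ (Θ₁ ∘ₗ b₁.baseChange ℂ) ∘ₗ π₁.toLinearMap.baseChange ℂ +
        ι₂.toLinearMap.baseChange ℂ ∘ₗ (Θ₂ ∘ₗ b₂.baseChange ℂ) ∘ₗ π₂.toLinearMap.baseChange ℂ := by
    apply LinearMap.ext
    intro y
    rw [hΘUdec, hbdec]
    simp only [Module.End.mul_apply, LinearMap.add_apply, LinearMap.comp_apply, map_add,
      proj_incl_baseChange hπι₁, proj_incl_baseChange hπι₂, proj_incl_baseChange_eq_zero hπ₁ι₂,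
      proj_incl_baseChange_eq_zero hπ₂ι₁, map_zero, add_zero, zero_add]
  have htr : ∀ {W : Type u} [AddCommGroup W] [Module ℚ W] [Module.Finite ℚ W] (ι : W →ₗ[ℚ] U) (π : U →ₗ[ℚ] W)
      (_h : π.baseChange ℂ ∘ₗ ι.baseChange ℂ = LinearMap.id) (Y : Module.End ℂ (ℂ ⊗[ℚ] W)),
      LinearMap.trace ℂ _ (ι.baseChange ℂ ∘ₗ Y ∘ₗ π.baseChange ℂ) = LinearMap.trace ℂ _ Y := by
    intro W _ _ _ ι π h Y
    rw [LinearMap.trace_comp_comm', LinearMap.comp_assoc, h, LinearMap.comp_id]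
  rw [hprod, map_add, htr _ _ hπι₁C, htr _ _ hπι₂C]
  rfl

end Presentation

end HodgeStructure

end Literature.AlgebraicGeometry.Motives

end
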